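import Summits.Ventures.QEC.Census.CertMitmLayers
import HarnessLib

/-!
# Soundness of the meet-in-the-middle replay, I: enumeration-structure lemmas and the pigeonhole over column groups

Lemmas for the soundness proof of `Census/CertCheckBZMitm.lean` (the in-kernel meet-in-the-middle replay of the
Brouwer–Zimmermann enumeration matrices of a `bz`/`bz_aut` certificate, CERT-FORMAT v1 §5.3):

* structure: `idxRows` as a map over the index range, membership and strict monotonicity; the pair table `pairXT`
  contains the first two elements of every SUBLIST; `direct3OK` / `probe5OK` reach the first three elements of every
  sublist; the leaf test unpacked (`mitmLeaf_imp`, via `popcFold_eq_popc`);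
* the systematic form: the bits of a XOR of distinct rows at the pivot columns (`testBit_xor_pivot`);
* **the pigeonhole** `exists_group_miss`: for CHECKED column groups (`groupsOK`: pairwise disjoint, outside the
  information set, below `2^n`), the XOR `c` of `|S|` distinct rows with `popc c ≤ W` and `W + 1 ≤ |S| + s` misses
  one of the `s` groups — `c` carries its `|S|` pivot bits outside every group, so fewer than `s` bits remain.

Tier KERNEL (axioms standard); no distance value is asserted. qec-search-9 (g2); reuses the word lemmas of
`Census/CertMitmLemmas.lean` (qec-type-07 g3), `Census/CertSystematicWeight.lean` and `Census/CertMitmLayers.lean`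
(qec-type-11 / qec-type-01), and the byte-parallel popcount of `Census/CertPopcount.lean` (qec-search-10 / qec-type-10).
-/

namespace Summit.Ventures.QEC.Census

/-! ## Soundness, part 1: enumeration structure lemmas -/

section Structure

open List

/-- `idxRows` is the map `k ↦ (k, G[k − k₀])` over the index range from `k₀`. -/
theorem idxRows_eq_map (G : List ℕ) (k₀ : ℕ) :
    idxRows G k₀ = (List.range' k₀ G.length).map fun k => (k, G.getD (k - k₀) 0) := by
  induction G generalizing k₀ with
  | nil => simp [idxRows]
  | cons g gs ih =>
    rw [idxRows, List.length_cons, List.range'_succ, List.map_cons, ih (k₀ + 1)]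
    simp only [Nat.sub_self, List.getD_cons_zero]
    congr 1
    refine List.map_congr_left fun k hk => ?_
    rw [List.mem_range'_1] at hk
    obtain ⟨d, rfl⟩ : ∃ d, k = k₀ + 1 + d := ⟨k - (k₀ + 1), by omega⟩
    simp [show k₀ + 1 + d - k₀ = d + 1 by omega]

/-- `idxRows G 0` is the map `k ↦ (k, G[k])` over `range |G|`. -/
theorem idxRows_zero (G : List ℕ) : idxRows G 0 = (List.range G.length).map fun k => (k, G.getD k 0) := by
  rw [idxRows_eq_map, List.range_eq_range']
  simp

/-- Membership in `idxRows G 0`. -/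
theorem mem_idxRows_zero {G : List ℕ} {r : ℕ × ℕ} : r ∈ idxRows G 0 ↔ r.1 < G.length ∧ r.2 = G.getD r.1 0 := by
  rw [idxRows_zero, List.mem_map]
  constructor
  · rintro ⟨k, hk, rfl⟩
    exact ⟨List.mem_range.1 hk, rfl⟩
  · rintro ⟨h1, h2⟩
    exact ⟨r.1, List.mem_range.2 h1, by ext <;> simp [h2]⟩

/-- The indices along `idxRows G 0` are strictly increasing. -/
theorem pairwise_idxRows_zero (G : List ℕ) : (idxRows G 0).Pairwise fun p q => p.1 < q.1 := by
  rw [idxRows_zero, List.pairwise_map]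
  exact List.pairwise_lt_range.imp (by intro a b h; exact h)

/-- The pair of the first two elements of a sublist `a :: b :: l'` of `rows` is an entry of `pairXT rows`. -/
theorem mem_pairXT_of_sublist {rows : List (ℕ × ℕ)} {a b : ℕ × ℕ} {l' : List (ℕ × ℕ)}
    (h : (a :: b :: l') <+ rows) : (a.1, b.1, a.2 ^^^ b.2) ∈ pairXT rows := by
  induction rows with
  | nil => exact absurd h (by simp)
  | cons r rest ih =>
    rw [pairXT, List.mem_append]
    cases h with
    | cons _ h' => exact Or.inr (ih h')
    | cons_cons _ h' =>
      left
      have hb : b ∈ rest := h'.subset (by simp)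
      exact List.mem_map.2 ⟨b, hb, rfl⟩

/-- `direct3OK` reaches the first three elements of any sublist. -/
theorem direct3OK_sublist {B W : ℕ} {allow : List ℕ} {rows : List (ℕ × ℕ)} (h : direct3OK B W allow rows = true)
    {a b c : ℕ × ℕ} {l' : List (ℕ × ℕ)} (hs : (a :: b :: c :: l') <+ rows) :
    mitmLeaf B W allow (a.2 ^^^ (b.2 ^^^ c.2)) = true := by
  induction rows with
  | nil => exact absurd hs (by simp)
  | cons r rest ih =>
    simp only [direct3OK, Bool.and_eq_true, List.all_eq_true] at h
    cases hs with
    | cons _ h' => exact ih h.2 h'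
    | cons_cons _ h' =>
      have := h.1 _ (mem_pairXT_of_sublist h')
      dsimp only at this
      exact this

/-- `probe5OK` reaches the first three elements of any sublist. -/
theorem probe5OK_sublist {B W : ℕ} {allow : List ℕ} {A n : ℕ} {tp : List ℕ × ℕ} {rows : List (ℕ × ℕ)}
    (h : probe5OK B W allow A n tp rows = true) {a b c : ℕ × ℕ} {l' : List (ℕ × ℕ)}
    (hs : (a :: b :: c :: l') <+ rows) : probeOK B W allow A n tp a.1 (a.2 ^^^ (b.2 ^^^ c.2)) = true := by
  induction rows with
  | nil => exact absurd hs (by simp)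
  | cons r rest ih =>
    simp only [probe5OK, Bool.and_eq_true, List.all_eq_true] at h
    cases hs with
    | cons _ h' => exact ih h.2 h'
    | cons_cons _ h' =>
      have := h.1 _ (mem_pairXT_of_sublist h')
      dsimp only at this
      exact this

/-- The leaf test unpacked: more than `W` bits (for a word of at most `B ≤ 31` bytes) or allow-listed. -/
theorem mitmLeaf_imp {B W : ℕ} {allow : List ℕ} {c : ℕ} (hB : B ≤ 31) (hc : c < 2 ^ (8 * B))
    (h : mitmLeaf B W allow c = true) : W < popc (8 * B) c ∨ c ∈ allow := by
  simp only [mitmLeaf, Bool.or_eq_true, List.any_eq_true, Nat.beq_eq] at h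
  rcases h with h | ⟨a, ha, rfl⟩
  · left
    have : W < popcFold B c := by simpa [Nat.blt_eq] using h
    rwa [popcFold_eq_popc hB hc] at this
  · exact Or.inr ha

end Structure


/-! ## Soundness, part 2: systematic form, pivots and the pigeonhole over column groups -/

section Pigeonhole

open Finset

variable {n : ℕ} {G T : List ℕ}

/-- `systematicOK` unpacked: equal lengths, columns `< n`, and the pivot pattern. -/
theorem systematicOK_spec (hsys : systematicOK n G T = true) :
    G.length = T.length ∧ (∀ q ∈ T, q < n) ∧
      ∀ j j', j < T.length → j' < T.length → (G.getD j 0).testBit (T.getD j' 0) = decide (j = j') := by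
  simp only [systematicOK, Bool.and_eq_true, beq_iff_eq, List.all_eq_true, List.mem_range, decide_eq_true_eq] at hsys
  obtain ⟨⟨hlen, hlt⟩, hpiv⟩ := hsys
  exact ⟨hlen, hlt, fun j j' hj hj' => hpiv j hj j' hj'⟩

/-- A word with a set bit at position `i` is at least `2^i`; so a word below `2^n` has no set bit at `i ≥ n`. -/
theorem lt_of_testBit_of_lt_two_pow {x i : ℕ} (hx : x < 2 ^ n) (h : x.testBit i = true) : i < n := by
  by_contra hi
  have : x < 2 ^ i := lt_of_lt_of_le hx (Nat.pow_le_pow_right (by norm_num) (by omega))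
  rw [Nat.testBit_lt_two_pow this] at h
  exact Bool.false_ne_true h

/-- A nonzero word has a set bit. -/
theorem exists_testBit_of_ne_zero {x : ℕ} (h : x ≠ 0) : ∃ i, x.testBit i = true := by
  by_contra h'
  push Not at h'
  exact h (Nat.eq_of_testBit_eq fun i => by rw [Nat.zero_testBit]; simpa using h' i)

/-- The bits of the XOR of a sub-row-list at a pivot column: set iff the pivot's row is in the list. -/
theorem testBit_xor_pivot (hsys : systematicOK n G T = true) (S : List (ℕ × ℕ))
    (hS : ∀ e ∈ S, e.1 < T.length ∧ e.2 = G.getD e.1 0) (hnd : (S.map Prod.fst).Nodup) {j' : ℕ}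
    (hj' : j' < T.length) : (xorList (S.map Prod.snd)).testBit (T.getD j' 0) = decide (j' ∈ S.map Prod.fst) := by
  obtain ⟨-, -, hpiv⟩ := systematicOK_spec hsys
  induction S with
  | nil => simp [xorList]
  | cons e S ih =>
    have he := hS e (by simp)
    rw [List.map_cons, List.map_cons, xorList, Nat.testBit_xor, he.2, hpiv e.1 j' he.1 hj',
      ih (fun x hx => hS x (by simp [hx])) (List.nodup_cons.1 (by simpa using hnd)).2]
    have hnot : e.1 ∉ S.map Prod.fst := (List.nodup_cons.1 (by simpa using hnd)).1
    by_cases h1 : e.1 = j'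
    · subst h1
      simp [hnot]
    · have : (j' ∈ e.1 :: S.map Prod.fst) ↔ j' ∈ S.map Prod.fst := by simp [Ne.symm h1]
      rw [List.mem_cons] at this
      simp only [h1, decide_false, Bool.false_xor, List.mem_cons]
      by_cases h2 : j' ∈ S.map Prod.fst <;> simp [h2, Ne.symm h1]

/-- The bit set of a word below `n`, as a set of naturals, has `popc n` elements. -/
theorem card_filter_testBit (n c : ℕ) : ((Finset.range n).filter fun i => c.testBit i = true).card = popc n c := by
  rw [← card_bitSet n c]
  refine (Finset.card_bij (fun (i : Fin n) _ => (i : ℕ)) (fun i hi => ?_) (fun i _ j _ h => Fin.ext h)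
    (fun i hi => ?_)).symm
  · rw [mem_bitSet] at hi
    exact Finset.mem_filter.2 ⟨Finset.mem_range.2 i.2, hi⟩
  · obtain ⟨hi1, hi2⟩ := Finset.mem_filter.1 hi
    exact ⟨⟨i, Finset.mem_range.1 hi1⟩, mem_bitSet.2 hi2, rfl⟩

/-- **Pigeonhole over the column groups.** For a matrix systematic on `T` and `s` checked groups, the XOR `c` of a
sub-row-list `S` (distinct rows) with `popc c ≤ W` and `W + 1 ≤ |S| + s` misses one of the groups entirely:
`c` has the `|S|` pivot bits (outside every group), so fewer than `s` further bits, and the groups are disjoint. -/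
theorem exists_group_miss (hsys : systematicOK n G T = true) {s : ℕ} (hgr : groupsOK n T s = true)
    (S : List (ℕ × ℕ)) (hS : ∀ e ∈ S, e.1 < T.length ∧ e.2 = G.getD e.1 0) (hnd : (S.map Prod.fst).Nodup)
    {W : ℕ} (hsW : W + 1 ≤ S.length + s) (hc : popc n (xorList (S.map Prod.snd)) ≤ W) :
    ∃ g, g < s ∧ xorList (S.map Prod.snd) &&& groupMask n T s g = 0 := by
  classical
  obtain ⟨hlen, hltn, hpiv⟩ := systematicOK_spec hsys
  set c := xorList (S.map Prod.snd) with hcdef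
  by_contra hne
  push Not at hne
  -- a set bit of `c` inside every group
  have hq : ∀ g, g < s → ∃ i, c.testBit i = true ∧ (groupMask n T s g).testBit i = true := by
    intro g hg
    obtain ⟨i, hi⟩ := exists_testBit_of_ne_zero (hne g hg)
    rw [Nat.testBit_and, Bool.and_eq_true] at hi
    exact ⟨i, hi⟩
  choose! q hqc hqA using hq
  -- the bit positions of `c` below `n`
  set Bn := (Finset.range n).filter fun i => c.testBit i = true with hBn
  -- group witnesses: `s` distinct positions, none of them a pivot
  set Q := (Finset.range s).image q with hQ
  have hQinj : Set.InjOn q ↑(Finset.range s) := by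
    intro g hg g' hg' hqq
    simp only [Finset.coe_range, Set.mem_Iio] at hg hg'
    by_contra hgg
    have h0 := (groupsOK_spec hgr).2.2 g g' hg hg' hgg
    have : (groupMask n T s g &&& groupMask n T s g').testBit (q g) = true := by
      rw [Nat.testBit_and, hqA g hg, hqq, hqA g' hg']; rfl
    rw [h0, Nat.zero_testBit] at this
    exact Bool.false_ne_true this
  have hQcard : Q.card = s := by rw [hQ, Finset.card_image_of_injOn hQinj, Finset.card_range]
  -- pivots: `|S|` distinct positions
  set Pv := (S.map Prod.fst).toFinset.image (fun j => T.getD j 0) with hPv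
  have hPinj : Set.InjOn (fun j => T.getD j 0) ↑(S.map Prod.fst).toFinset := by
    intro j hj j' hj' hjj
    simp only [List.coe_toFinset, Set.mem_setOf_eq, List.mem_map] at hj hj'
    obtain ⟨e, he, rfl⟩ := hj
    obtain ⟨e', he', rfl⟩ := hj'
    exact getD_injOn_of_systematicOK hsys (hS e he).1 (hS e' he').1 hjj
  have hPcard : Pv.card = S.length := by
    rw [hPv, Finset.card_image_of_injOn hPinj, List.toFinset_card_of_nodup hnd, List.length_map]
  -- disjoint
  have hdisj : Disjoint Q Pv := by
    rw [Finset.disjoint_left]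
    intro i hiQ hiP
    rw [hQ, Finset.mem_image] at hiQ
    obtain ⟨g, hg, rfl⟩ := hiQ
    rw [Finset.mem_range] at hg
    rw [hPv, Finset.mem_image] at hiP
    obtain ⟨j, hj, hjq⟩ := hiP
    rw [List.mem_toFinset, List.mem_map] at hj
    obtain ⟨e, he, rfl⟩ := hj
    have hT : (maskOf T).testBit (q g) = true := by
      rw [← hjq, testBit_maskOf, decide_eq_true_eq]
      exact getD_mem_of_lt _ (hS e he).1
    have h0 := (groupsOK_spec hgr).1 g hg
    have : (groupMask n T s g &&& maskOf T).testBit (q g) = true := by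
      rw [Nat.testBit_and, hqA g hg, hT]; rfl
    rw [h0, Nat.zero_testBit] at this
    exact Bool.false_ne_true this
  -- both inside the bit set of `c`
  have hsub : Q ∪ Pv ⊆ Bn := by
    intro i hi
    rw [hBn, Finset.mem_filter, Finset.mem_range]
    rcases Finset.mem_union.1 hi with hiQ | hiP
    · rw [hQ, Finset.mem_image] at hiQ
      obtain ⟨g, hg, rfl⟩ := hiQ
      rw [Finset.mem_range] at hg
      exact ⟨lt_of_testBit_of_lt_two_pow ((groupsOK_spec hgr).2.1 g hg) (hqA g hg), hqc g hg⟩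
    · rw [hPv, Finset.mem_image] at hiP
      obtain ⟨j, hj, rfl⟩ := hiP
      rw [List.mem_toFinset] at hj
      obtain ⟨e, he, hej⟩ := List.mem_map.1 hj
      have hjl : j < T.length := hej ▸ (hS e he).1
      refine ⟨hltn _ (getD_mem_of_lt _ hjl), ?_⟩
      rw [hcdef, testBit_xor_pivot hsys S hS hnd hjl, decide_eq_true_eq]
      exact hj
  have := Finset.card_le_card hsub
  rw [Finset.card_union_of_disjoint hdisj, hQcard, hPcard, hBn, card_filter_testBit] at this
  omega

end Pigeonhole

end Summit.Ventures.QEC.Census
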